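/-
Copyright (c) 2026 the pub-hodgecm-mathlib formalisation cell (harness21).  Prover seat hodgecm-mathlib-F0P3a-p01 (g23), 2026-09-03.  E1 row 48 «(SS-O) ELLIPTIC UNFOLDING ASSEMBLY»,
DATUM FILE (E1 keeper ∕ dealer F0P3a-p03 (g29) 02:31:24Z «datum SECOND, --as helper»; (g30) 02:50:02Z); census `F0/P3a/F0P3a-p01/g23/r48/CENSUS-R48-SSO-elliptic-unfolding.v1.F0P3ap01g23.md`.
-/
import Summits.HodgeConjecture.HodgeConjecture.Theorems.F0P3cStCharTSEPFunctionOrbitalOrbits       -- FILE 1 of 2 (this seat): the three facet orbits at the datum; brings ★ 41g-H's letters and ★ R48-gen FILE 2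
import Literature.NumberTheory.Automorphic.SmoothCharacterEPFunctionOrbitalSum                   -- ★ R48-gen FILE 2 (this seat) p853346: one-orbit unfolding, additivity, EP-sum head
import Literature.NumberTheory.Automorphic.UnitOrbitalIntegralFixedPointsVolume                 -- ★ the `G_v` socket letters: `isRegularElt_val_conj`, `isClosed_conjClass_local_of_isRegularElt`
import Literature.NumberTheory.Automorphic.UnitaryLatticeTreeEulerRelation                      -- ★ E4 EULER-G (LH7): `forall_flag_exists_unitary` (one edge orbit)
import Literature.NumberTheory.Automorphic.UnitaryLatticeTreeTypeTwoTransitive                  -- ★ 39β: `exists_mapGL_N₁_eq_of_isVertexLattice_two` (one type-2 orbit), `v_det`∕types via Apartment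
import Literature.NumberTheory.Automorphic.UnitaryLatticeTreeSelfDualTransitiveOfTrace          -- ★ `exists_unitary_mapGL_stdLattice_eq_of_isSelfDualLattice_of_trace` (one self-dual orbit)
import Literature.Combinatorics.SimpleGraph.GraphAutomorphismsOneForms                                 -- ★ `BakerNorine.coe_mapEdgeSet`, `mapEdgeSet_mul`, `mapEdgeSet_one` (edge action bookkeeping)
import HarnessLib

/-!
# F0 · P3c · line LH6 «StCharTS» — E1 row 48 DATUM, FILE 2 of 2 «THE HEAD»: the orbital integral of an Euler–Poincaré sum of `K`-type functions on `G_v = U(Φ₃)(L⁺_v)` at a regular elliptic class,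
# unfolded over the `γ`-fixed vertices and edges of the Bruhat–Tits tree — the ORBITAL twin of ★ 41g-H `char_eq_fixedVertexSum_sub_fixedEdgeSum`, in its currency
# ([SchneiderStuhler1997 §III.4], [Kottwitz1988 §2], [Rogawski1990 §4.9, §12.5])

Cell `pub/hodgecm-mathlib` (D-0151), crux H413 = `stmt-HodgeConjecture-24833`; lane `--kind proof --supports stmt-HodgeConjecture-24833 --as helper` (THEOREMS ONLY: no definition ∕
instance ∕ notation ∕ named fact ∕ `sorry`; count-neutral: closes no node).  Namespace `Summit.HodgeConjecture.HodgeConjecture.Cruxes.H413.F0P3cStCharTSEPFunctionOrbitalElliptic`.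
HONEST LABEL: (R-SS) NOT chartered; E1 = PRINT until the keeper's charter test; h413 OPEN; HC_CM is proved only modulo the printed citations (2 remaining named inputs hLiu418 =
stmt-HodgeConjecture-24832, h413 = stmt-HodgeConjecture-24833) until rung 0 closes; nothing printed is asserted here.

LETTERS = ★ 41g-H's: `(w hw ϖ hd eA)` the (G3)-EXPLICIT one-place model, `{a} ha` the action hom `G_v →* Aut(tree)`, `(τ) hτ` an invariant orientation (`tail < head`), `{e U} hU` the
unitary level family at level `ϖ^(e+1)` with `hUo hUc hEo hEc`, `hfin`∕`hfinE` the finite `γ`-fixed vertex∕edge sets; PLUS `(νQv) (hcanQ)` ((G3)-EXPLICIT measure letters), `hreg`∕`hell`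
(regular elliptic `γ`), a base edge `d₁` (its head `o₀ := τ.head d₁` is self-dual, its tail `o₂ := τ.tail d₁` of type two — ★ `type_of_lt_three`), the three stabilisers `P₀ P₂ P₁`
(hypothesis-style `hP₀ hP₂ hP₁`), and three `K`-type pieces `fᵢ = 𝟙_{Pᵢ} · χ_{τᵢ}(·⁻¹)` in ★ row 42's letters `hfPᵢ`∕`hf0ᵢ` with `τᵢ = ρ|_{Pᵢ}` on `V^{Uᵢ}` (`hτρᵢ`) trivial on `Uᵢ`
(`hτᵢ`, membership form), `U₀ = U o₀`, `U₂ = U o₂`, `U₁ = U (τ.head d₁) ⊔ U (τ.tail d₁)`.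

* THE HEAD **`classOrbitalIntegral_epSum_eq_fixedVertexSum_sub_fixedEdgeSum`** (FILE 2 of 2; FILE 1 = `F0P3cStCharTSEPFunctionOrbitalOrbits`, the three facet orbits):
  `classOrbitalIntegral mQv ((ν P₀)⁻¹ • f₀ + (ν P₂)⁻¹ • f₂ − (ν P₁)⁻¹ • f₁) ⟦γ⟧ = (∑ x ∈ hfin.toFinset, ρ.levelTrace (hUo x) (hUc x) γ⁻¹) − ∑ d ∈ hfinE.toFinset, ρ.levelTrace (hEo d) (hEc d) γ⁻¹`
  — FILE 1's per-orbit unfoldings on the self-dual vertices, the type-two vertices and the edges, ★ R48-gen FILE 2 §2 additivity, the regrouping `X⁰ = X⁰_{sd} ⊔ X⁰_{2}`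
  (★ `type_eq_zero_or_two_of_isVertexLattice_three`, ★ `not_isSelfDualLattice_of_isVertexLattice_two`) and FILE 1's `epSum_arith`.
With ★ 41g-H (`𝔇.char π γ = Σ_x Θ_{U_x}(γ) − Σ_d Θ_{U_d}(γ)` at `e ≥ e₀`) and level-trace unitarity `Θ_U(γ⁻¹) = conj Θ_U(γ)` this is K1's elliptic clause `Φ(γ, f_EP) = conj Θ_π(γ)`
(the E1 charter test's business, not this file's).

## References
* [SchneiderStuhler1997] P. Schneider, U. Stuhler, *Representation theory and sheaves on the Bruhat–Tits building*, Publ. Math. IHÉS 85 (1997): §III.4.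
* [Kottwitz1988] R. E. Kottwitz, *Tamagawa numbers*, Ann. of Math. 127 (1988): §2.
* [Rogawski1990] J. D. Rogawski, *Automorphic Representations of Unitary Groups in Three Variables* (1990): §4.9 p. 54, §12.5 pp. 182–187.
* [BruhatTits1972] F. Bruhat, J. Tits, *Groupes réductifs sur un corps local* I, Publ. Math. IHÉS 41 (1972): §10.
-/

set_option autoImplicit false

set_option linter.dupNamespace false

noncomputable section

open NumberField IsDedekindDomain MeasureTheory Measure
open scoped Pointwise Valued WithZero Matrix MatrixGroups
open Literature.NumberTheory.Rogawski1990 Literature.NumberTheory.Rogawski1990.Ch12Sec5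
open Literature.NumberTheory.Automorphic Literature.NumberTheory.Automorphic.UnitaryGroup Literature.NumberTheory.Automorphic.UnitaryLatticeTree
open Literature.NumberTheory.Automorphic.HermitianLattice Literature.NumberTheory.GaloisRepresentations
open Literature.Combinatorics.SimpleGraph Literature.Combinatorics.SimpleGraph.OrientedIncidence

namespace Summit.HodgeConjecture.HodgeConjecture.Cruxes.H413.F0P3cStCharTSEPFunctionOrbitalElliptic

open Summit.HodgeConjecture.HodgeConjecture.Cruxes.H413
open Summit.HodgeConjecture.HodgeConjecture.Cruxes.H413.F0P3cStCharTSCharacterEllipticUniform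

open Summit.HodgeConjecture.HodgeConjecture.Cruxes.H413.F0P3cStCharTSEPFunctionOrbitalOrbits

/-! ## THE HEAD: (SS-O) at the datum -/

section Head

variable (L : Type) [Field L] [NumberField L] [IsCMField L] (v : HeightOneSpectrum (𝓞 ↥(maximalRealSubfield L)))

set_option maxHeartbeats 1600000 in
/-- **(SS-O) AT THE DATUM — the orbital integral of an Euler–Poincaré sum of `K`-type functions on the `U(Φ₃)(L⁺_v)` tree at a regular elliptic class, unfolded over the
`γ`-fixed vertices and edges** ([SchneiderStuhler1997 §III.4], [Kottwitz1988 §2]; census R48 (A1)–(A6) @ datum; ★ R48-gen FILE 2 over ★ 41g-H's letters).  At a place `v` with the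
(G3)-EXPLICIT one-place model `(w hw ϖ hd eA)`, for the action hom `a` and the unitary level family `U` at level `ϖ^(e+1)` (hypothesis-style `ha hU`, binders `hUo hUc hEo hEc`), a
Haar measure `νQv` and a family `mQv` canonical for (`IsRegularElt`, `νQv`) (`hcanQ`), a base edge `d₁` with stabilisers `P₀ = Stab(τ.head d₁)`, `P₂ = Stab(τ.tail d₁)`,
`P₁ = Stab(d₁)` (`hP₀ hP₂ hP₁`), a representation `ρ` with the three `K`-type pieces `f₀ f₂ f₁` (★ row 42 letters: `fᵢ = 𝟙_{Pᵢ}·χ_{τᵢ}(·⁻¹)`, `τᵢ = ρ|_{Pᵢ}` on `V^{Uᵢ}`, trivial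
on `Uᵢ`), and `γ` regular (`hreg`) with compact centraliser (`hell`) and finite fixed tree (`hfin`, `hfinE`):
`Φ^{can}(γ, (ν P₀)⁻¹ f₀ + (ν P₂)⁻¹ f₂ − (ν P₁)⁻¹ f₁) = Σ_{x ∈ X^γ⁰} Θ_{U_x}(γ⁻¹) − Σ_{d ∈ X^γ¹} Θ_{U_d}(γ⁻¹)`.
[cite: SchneiderStuhler1997, §III.4] [cite: Kottwitz1988, §2 Theorem 2] [cite: Rogawski1990, §4.9 p. 54; §12.5 pp. 182–187] [cite: BruhatTits1972, §10] -/
theorem classOrbitalIntegral_epSum_eq_fixedVertexSum_sub_fixedEdgeSum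
    (w : PlacesOver L v) (hw : IsCMField.complexConj L • w.1 = w.1) {ϖ : (w.1.adicCompletion L)} (hd : UnramifiedLocalConjDatum (galAdicCompletionMap (L := L) (IsCMField.complexConj L) hw) ϖ)
    (eA : (Gqs L v) ≃ₜ* ↥(unitaryGroupOfForm (galAdicCompletionMap (L := L) (IsCMField.complexConj L) hw) ((StdForm.antidiagonal 3).over (w.1.adicCompletion L))))
    {a : (Gqs L v) →* ((latticeGraph (galAdicCompletionMap (L := L) (IsCMField.complexConj L) hw) ϖ ((StdForm.antidiagonal 3).over (w.1.adicCompletion L))) ≃g (latticeGraph (galAdicCompletionMap (L := L) (IsCMField.complexConj L) hw) ϖ ((StdForm.antidiagonal 3).over (w.1.adicCompletion L))))} (ha : ∀ g, a g = latticeGraphIso (galAdicCompletionMap (L := L) (IsCMField.complexConj L) hw) ϖ ((StdForm.antidiagonal 3).over (w.1.adicCompletion L)) (eA g))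
    [MeasurableSpace (Gqs L v)] [BorelSpace (Gqs L v)]
    [∀ γ : (Gqs L v), MeasurableSpace ((Gqs L v) ⧸ Subgroup.centralizer ({γ} : Set (Gqs L v)))]
    [∀ γ : (Gqs L v), BorelSpace ((Gqs L v) ⧸ Subgroup.centralizer ({γ} : Set (Gqs L v)))]
    (νQv : Measure (Gqs L v)) [νQv.IsHaarMeasure] [νQv.IsMulRightInvariant]
    {mQv : OrbitalMeasureFamily (Gqs L v)} (hcanQ : mQv.IsCanonical (fun γ => IsRegularElt (γ.val : GL (Fin 3) (UnitaryGroup.LocalRing L v))) νQv)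
    (τ : Orientation (latticeGraph (galAdicCompletionMap (L := L) (IsCMField.complexConj L) hw) ϖ ((StdForm.antidiagonal 3).over (w.1.adicCompletion L)))) (hτ : ∀ d, τ.tail d < τ.head d)
    {e : ℕ} {U : {M : Submodule 𝒪[(w.1.adicCompletion L)] (Fin 3 → (w.1.adicCompletion L)) // IsVertex (galAdicCompletionMap (L := L) (IsCMField.complexConj L) hw) ϖ ((StdForm.antidiagonal 3).over (w.1.adicCompletion L)) M} → Subgroup (Gqs L v)}
    (hU : ∀ x g, g ∈ U x ↔ mapGL ((eA g : ↥(unitaryGroupOfForm (galAdicCompletionMap (L := L) (IsCMField.complexConj L) hw) ((StdForm.antidiagonal 3).over (w.1.adicCompletion L)))) : GL (Fin 3) (w.1.adicCompletion L)) x.1 = x.1 ∧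
      x.1.map ((Matrix.toLin' ((((eA g : ↥(unitaryGroupOfForm (galAdicCompletionMap (L := L) (IsCMField.complexConj L) hw) ((StdForm.antidiagonal 3).over (w.1.adicCompletion L)))) : GL (Fin 3) (w.1.adicCompletion L)) : Matrix (Fin 3) (Fin 3) (w.1.adicCompletion L)) - 1)).restrictScalars 𝒪[(w.1.adicCompletion L)]) ≤ scaleLattice (ϖ ^ (e + 1)) x.1)
    (hUo : ∀ x, IsOpen (U x : Set (Gqs L v))) (hUc : ∀ x, IsCompact (U x : Set (Gqs L v)))
    (hEo : ∀ d : (latticeGraph (galAdicCompletionMap (L := L) (IsCMField.complexConj L) hw) ϖ ((StdForm.antidiagonal 3).over (w.1.adicCompletion L))).edgeSet, IsOpen ((U (τ.head d) ⊔ U (τ.tail d) : Subgroup (Gqs L v)) : Set (Gqs L v)))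
    (hEc : ∀ d : (latticeGraph (galAdicCompletionMap (L := L) (IsCMField.complexConj L) hw) ϖ ((StdForm.antidiagonal 3).over (w.1.adicCompletion L))).edgeSet, IsCompact ((U (τ.head d) ⊔ U (τ.tail d) : Subgroup (Gqs L v)) : Set (Gqs L v)))
    (d₁ : (latticeGraph (galAdicCompletionMap (L := L) (IsCMField.complexConj L) hw) ϖ ((StdForm.antidiagonal 3).over (w.1.adicCompletion L))).edgeSet) (P₀ P₂ P₁ : Subgroup (Gqs L v))
    (hP₀ : ∀ g, g ∈ P₀ ↔ a g (τ.head d₁) = τ.head d₁) (hP₂ : ∀ g, g ∈ P₂ ↔ a g (τ.tail d₁) = τ.tail d₁) (hP₁ : ∀ g, g ∈ P₁ ↔ (a g).mapEdgeSet d₁ = d₁)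
    {V : Type*} [AddCommGroup V] [Module ℂ V] (ρ : Representation ℂ (Gqs L v) V)
    [FiniteDimensional ℂ ↥(ρ.fixedPoints (U (τ.head d₁)))] [FiniteDimensional ℂ ↥(ρ.fixedPoints (U (τ.tail d₁)))]
    [FiniteDimensional ℂ ↥(ρ.fixedPoints (U (τ.head d₁) ⊔ U (τ.tail d₁)))]
    (τ₀ : Representation ℂ ↥P₀ ↥(ρ.fixedPoints (U (τ.head d₁))))
    (hτρ₀ : ∀ (p : ↥P₀) (x : ↥(ρ.fixedPoints (U (τ.head d₁)))), ((τ₀ p x : ↥(ρ.fixedPoints (U (τ.head d₁)))) : V) = ρ (p : (Gqs L v)) (x : V))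
    (hτ₀ : ∀ p : ↥P₀, (p : (Gqs L v)) ∈ U (τ.head d₁) → τ₀ p = 1)
    (τ₂ : Representation ℂ ↥P₂ ↥(ρ.fixedPoints (U (τ.tail d₁))))
    (hτρ₂ : ∀ (p : ↥P₂) (x : ↥(ρ.fixedPoints (U (τ.tail d₁)))), ((τ₂ p x : ↥(ρ.fixedPoints (U (τ.tail d₁)))) : V) = ρ (p : (Gqs L v)) (x : V))
    (hτ₂ : ∀ p : ↥P₂, (p : (Gqs L v)) ∈ U (τ.tail d₁) → τ₂ p = 1)
    (τ₁ : Representation ℂ ↥P₁ ↥(ρ.fixedPoints (U (τ.head d₁) ⊔ U (τ.tail d₁))))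
    (hτρ₁ : ∀ (p : ↥P₁) (x : ↥(ρ.fixedPoints (U (τ.head d₁) ⊔ U (τ.tail d₁)))), ((τ₁ p x : ↥(ρ.fixedPoints (U (τ.head d₁) ⊔ U (τ.tail d₁)))) : V) = ρ (p : (Gqs L v)) (x : V))
    (hτ₁ : ∀ p : ↥P₁, (p : (Gqs L v)) ∈ U (τ.head d₁) ⊔ U (τ.tail d₁) → τ₁ p = 1)
    {f₀ f₂ f₁ : (Gqs L v) → ℂ}
    (hfP₀ : ∀ (g : (Gqs L v)) (hg : g ∈ P₀), f₀ g = Representation.character τ₀ ⟨g, hg⟩⁻¹) (hf0₀ : ∀ g ∉ P₀, f₀ g = 0)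
    (hfP₂ : ∀ (g : (Gqs L v)) (hg : g ∈ P₂), f₂ g = Representation.character τ₂ ⟨g, hg⟩⁻¹) (hf0₂ : ∀ g ∉ P₂, f₂ g = 0)
    (hfP₁ : ∀ (g : (Gqs L v)) (hg : g ∈ P₁), f₁ g = Representation.character τ₁ ⟨g, hg⟩⁻¹) (hf0₁ : ∀ g ∉ P₁, f₁ g = 0)
    {γ : (Gqs L v)} (hreg : IsRegularElt (γ.val : GL (Fin 3) (UnitaryGroup.LocalRing L v)))
    (hell : IsCompact ((Subgroup.centralizer ({γ} : Set (Gqs L v))) : Set (Gqs L v)))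
    (hfin : {x : {M : Submodule 𝒪[(w.1.adicCompletion L)] (Fin 3 → (w.1.adicCompletion L)) // IsVertex (galAdicCompletionMap (L := L) (IsCMField.complexConj L) hw) ϖ ((StdForm.antidiagonal 3).over (w.1.adicCompletion L)) M} | a γ x = x}.Finite) (hfinE : {d : (latticeGraph (galAdicCompletionMap (L := L) (IsCMField.complexConj L) hw) ϖ ((StdForm.antidiagonal 3).over (w.1.adicCompletion L))).edgeSet | (a γ).mapEdgeSet d = d}.Finite) :
    classOrbitalIntegral mQv
        ((((νQv.real (P₀ : Set (Gqs L v)))⁻¹ : ℂ)) • f₀ + (((νQv.real (P₂ : Set (Gqs L v)))⁻¹ : ℂ)) • f₂ - (((νQv.real (P₁ : Set (Gqs L v)))⁻¹ : ℂ)) • f₁) (ConjClasses.mk γ) =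
      (∑ x ∈ hfin.toFinset, ρ.levelTrace (hUo x) (hUc x) γ⁻¹) - ∑ d ∈ hfinE.toFinset, ρ.levelTrace (hEo d) (hEc d) γ⁻¹ := by
  classical
  have hHf : ((qsForm L).map (cmConjRingHom L))ᵀ = qsForm L := UnitaryGroup.antidiagOne_isHermitian L 3
  have hdetf : (qsForm L).det ≠ 0 := (UnitaryGroup.isUnit_antidiagOne_det L 3).ne_zero
  have hQ : ∀ g x : (Gqs L v), IsRegularElt (g.val : GL (Fin 3) (UnitaryGroup.LocalRing L v)) →
      IsRegularElt ((x * g * x⁻¹ : (Gqs L v)).val : GL (Fin 3) (UnitaryGroup.LocalRing L v)) := fun g x hg => UnitaryGroup.isRegularElt_val_conj L 3 (qsForm L) v g x hg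
  haveI : CompactSpace (Subgroup.centralizer ({γ} : Set (Gqs L v))) := isCompact_iff_compactSpace.1 hell
  have hO : IsClosed {x : (Gqs L v) | ∃ y : (Gqs L v), y * γ * y⁻¹ = x} := UnitaryGroup.isClosed_conjClass_local_of_isRegularElt L 3 (qsForm L) v hHf hdetf γ hreg
  have hne : ∀ P : Subgroup (Gqs L v), IsOpen (P : Set (Gqs L v)) → IsCompact (P : Set (Gqs L v)) → (νQv.real (P : Set (Gqs L v)) : ℂ) ≠ 0 := fun P hPo hPc => by
    rw [Ne, Complex.ofReal_eq_zero]
    exact (measureReal_pos_of_isCompact_isOpen νQv hPo hPc).ne'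
  have hJ : Valued.v (((StdForm.antidiagonal 3).over (w.1.adicCompletion L))).det = 1 := v_det_antidiagonal_three
  -- «a fixed edge has fixed ends» (no inversion)
  have hfixE : ∀ (g : (Gqs L v)) (d : (latticeGraph (galAdicCompletionMap (L := L) (IsCMField.complexConj L) hw) ϖ ((StdForm.antidiagonal 3).over (w.1.adicCompletion L))).edgeSet), (a g).mapEdgeSet d = d ↔ a g (τ.head d) = τ.head d ∧ a g (τ.tail d) = τ.tail d :=
    mapEdgeSet_eq_iff L v w hw eA ha τ hτ
  have hadj₁ : (latticeGraph (galAdicCompletionMap (L := L) (IsCMField.complexConj L) hw) ϖ ((StdForm.antidiagonal 3).over (w.1.adicCompletion L))).Adj (τ.head d₁) (τ.tail d₁) := τ.adj_head_tail d₁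
  -- types of the ends of `d₁`; the three stabilisers are compact open; `Uᵢ ≤ Pᵢ`
  obtain ⟨k₀, hk₀⟩ := (τ.head d₁).2
  obtain ⟨k₂, hk₂⟩ := (τ.tail d₁).2
  obtain ⟨hk₂2, hk₀0⟩ := type_of_lt_three hd.vσ hd.vϖ hJ hk₂ hk₀ (Subtype.coe_lt_coe.2 (hτ d₁))
  subst hk₂2 hk₀0
  have hP₀o : IsOpen (P₀ : Set (Gqs L v)) := by rw [Set.ext hP₀]; exact isOpen_setOf_actionHom_apply_eq ha (τ.head d₁)
  have hP₀c : IsCompact (P₀ : Set (Gqs L v)) := by rw [Set.ext hP₀]; exact isCompact_setOf_actionHom_apply_eq L v w hw eA ha (τ.head d₁)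
  have hP₂o : IsOpen (P₂ : Set (Gqs L v)) := by rw [Set.ext hP₂]; exact isOpen_setOf_actionHom_apply_eq ha (τ.tail d₁)
  have hP₂c : IsCompact (P₂ : Set (Gqs L v)) := by rw [Set.ext hP₂]; exact isCompact_setOf_actionHom_apply_eq L v w hw eA ha (τ.tail d₁)
  have hUP₀ : U (τ.head d₁) ≤ P₀ := fun u hu => (hP₀ u).2 (actionHom_apply_eq_of_mem ha hU hu)
  have hUP₂ : U (τ.tail d₁) ≤ P₂ := fun u hu => (hP₂ u).2 (actionHom_apply_eq_of_mem ha hU hu)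
  have hUP₁ : U (τ.head d₁) ⊔ U (τ.tail d₁) ≤ P₁ :=
    sup_le (fun u hu => (hP₁ u).2 ((hfixE u d₁).2 ⟨actionHom_apply_eq_of_mem ha hU hu, actionHom_apply_eq_of_mem_of_adj ha hU hd hu hadj₁⟩))
      (fun u hu => (hP₁ u).2 ((hfixE u d₁).2 ⟨actionHom_apply_eq_of_mem_of_adj ha hU hd hu hadj₁.symm, actionHom_apply_eq_of_mem ha hU hu⟩))
  have hP₁P₀ : (P₁ : Set (Gqs L v)) ⊆ (P₀ : Set (Gqs L v)) := fun g hg => (hP₀ g).2 ((hfixE g d₁).1 ((hP₁ g).1 hg)).1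
  have hP₁o : IsOpen (P₁ : Set (Gqs L v)) := Subgroup.isOpen_mono hUP₁ (hEo d₁)
  have hP₁c : IsCompact (P₁ : Set (Gqs L v)) := hP₀c.of_isClosed_subset (Subgroup.isClosed_of_isOpen P₁ hP₁o) hP₁P₀
  -- the three orbit terms (§2)
  have h₀ := classOrbitalIntegral_kType_vertex_eq L v w hw eA ha νQv hcanQ hU hUo hUc (exists_actionHom_apply_eq_of_isVertexLattice_zero L v w hw hd eA ha)
    (τ.head d₁) hk₀ P₀ hP₀ ρ τ₀ hτρ₀ hτ₀ hfP₀ hf0₀ hreg hell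
  have h₂ := classOrbitalIntegral_kType_vertex_eq L v w hw eA ha νQv hcanQ hU hUo hUc (exists_actionHom_apply_eq_of_isVertexLattice_two L v w hw hd eA ha)
    (τ.tail d₁) hk₂ P₂ hP₂ ρ τ₂ hτρ₂ hτ₂ hfP₂ hf0₂ hreg hell
  have h₁ := classOrbitalIntegral_kType_edge_eq L v w hw hd eA ha νQv hcanQ τ hτ hU hEo hEc d₁ P₁ hP₁ ρ τ₁ hτρ₁ hτ₁ hfP₁ hf0₁ hreg hell
  -- additivity (★ FILE 2 §2, family indexed by `Fin 3`)
  have hsum := classOrbitalIntegral_finset_sum_smul_of_isClosed hQ hcanQ hreg hO Finset.univ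
    ![((νQv.real (P₀ : Set (Gqs L v)))⁻¹ : ℂ), ((νQv.real (P₂ : Set (Gqs L v)))⁻¹ : ℂ), -((νQv.real (P₁ : Set (Gqs L v)))⁻¹ : ℂ)] ![f₀, f₂, f₁]
    (fun i _ => by
      fin_cases i
      · exact Representation.continuous_of_kType (hUo (τ.head d₁)) hUP₀ τ₀ (fun u hu => hτ₀ ⟨u, hUP₀ hu⟩ hu) hfP₀ hf0₀
      · exact Representation.continuous_of_kType (hUo (τ.tail d₁)) hUP₂ τ₂ (fun u hu => hτ₂ ⟨u, hUP₂ hu⟩ hu) hfP₂ hf0₂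
      · exact Representation.continuous_of_kType (hEo d₁) hUP₁ τ₁ (fun u hu => hτ₁ ⟨u, hUP₁ hu⟩ hu) hfP₁ hf0₁)
    (fun i _ => by
      fin_cases i
      · exact HasCompactSupport.of_support_subset_isCompact hP₀c (Representation.support_kType_subset hf0₀)
      · exact HasCompactSupport.of_support_subset_isCompact hP₂c (Representation.support_kType_subset hf0₂)
      · exact HasCompactSupport.of_support_subset_isCompact hP₁c (Representation.support_kType_subset hf0₁))
  have hEP : (((νQv.real (P₀ : Set (Gqs L v)))⁻¹ : ℂ)) • f₀ + (((νQv.real (P₂ : Set (Gqs L v)))⁻¹ : ℂ)) • f₂ - (((νQv.real (P₁ : Set (Gqs L v)))⁻¹ : ℂ)) • f₁ =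
      ∑ i : Fin 3, (![((νQv.real (P₀ : Set (Gqs L v)))⁻¹ : ℂ), ((νQv.real (P₂ : Set (Gqs L v)))⁻¹ : ℂ), -((νQv.real (P₁ : Set (Gqs L v)))⁻¹ : ℂ)] i) • (![f₀, f₂, f₁] i) := by
    rw [Fin.sum_univ_three]
    simp only [Matrix.cons_val_zero, Matrix.cons_val_one, Matrix.cons_val_two, Matrix.head_cons, Matrix.tail_cons, neg_smul, sub_eq_add_neg]
  -- regrouping: `X^γ⁰ = X^γ⁰_{self-dual} ⊔ X^γ⁰_{type two}`
  have hcover : {x : {M : Submodule 𝒪[(w.1.adicCompletion L)] (Fin 3 → (w.1.adicCompletion L)) // IsVertex (galAdicCompletionMap (L := L) (IsCMField.complexConj L) hw) ϖ ((StdForm.antidiagonal 3).over (w.1.adicCompletion L)) M} | a γ x = x ∧ IsVertexLattice (galAdicCompletionMap (L := L) (IsCMField.complexConj L) hw) ϖ ((StdForm.antidiagonal 3).over (w.1.adicCompletion L)) 0 x.1} ∪ {x : {M : Submodule 𝒪[(w.1.adicCompletion L)] (Fin 3 → (w.1.adicCompletion L)) // IsVertex (galAdicCompletionMap (L := L) (IsCMField.complexConj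 L) hw) ϖ ((StdForm.antidiagonal 3).over (w.1.adicCompletion L)) M} | a γ x = x ∧ IsVertexLattice (galAdicCompletionMap (L := L) (IsCMField.complexConj L) hw) ϖ ((StdForm.antidiagonal 3).over (w.1.adicCompletion L)) 2 x.1} =
      {x : {M : Submodule 𝒪[(w.1.adicCompletion L)] (Fin 3 → (w.1.adicCompletion L)) // IsVertex (galAdicCompletionMap (L := L) (IsCMField.complexConj L) hw) ϖ ((StdForm.antidiagonal 3).over (w.1.adicCompletion L)) M} | a γ x = x} := by
    ext x
    simp only [Set.mem_union, Set.mem_setOf_eq]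
    constructor
    · rintro (h | h) <;> exact h.1
    · intro h
      obtain ⟨k, hk⟩ := x.2
      rcases type_eq_zero_or_two_of_isVertexLattice_three hd.vσ hd.vϖ hJ hk with rfl | rfl
      · exact Or.inl ⟨h, hk⟩
      · exact Or.inr ⟨h, hk⟩
  have hdisj : Disjoint {x : {M : Submodule 𝒪[(w.1.adicCompletion L)] (Fin 3 → (w.1.adicCompletion L)) // IsVertex (galAdicCompletionMap (L := L) (IsCMField.complexConj L) hw) ϖ ((StdForm.antidiagonal 3).over (w.1.adicCompletion L)) M} | a γ x = x ∧ IsVertexLattice (galAdicCompletionMap (L := L) (IsCMField.complexConj L) hw) ϖ ((StdForm.antidiagonal 3).over (w.1.adicCompletion L)) 0 x.1} {x : {M : Submodule 𝒪[(w.1.adicCompletion L)] (Fin 3 → (w.1.adicCompletion L)) // IsVertex (galAdicCompletionMap (L := L) (IsCMField.complexConj L) hw) ϖ ((StdForm.antidiagonal 3).over (w.1.adicCompletion L)) M} | a γ x = x ∧ IsVertexLattice (galAdicCompletionMap (L := L) (IsCMField.complexConj L) hw) ϖ ((StdForm.antidiagonal 3).over (w.1.adicCompletion L)) 2 x.1}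 :=
    Set.disjoint_left.2 fun x h0 h2 => not_isSelfDualLattice_of_isVertexLattice_two hd h2.2 h0.2
  have hvert : (∑ᶠ x ∈ {x : {M : Submodule 𝒪[(w.1.adicCompletion L)] (Fin 3 → (w.1.adicCompletion L)) // IsVertex (galAdicCompletionMap (L := L) (IsCMField.complexConj L) hw) ϖ ((StdForm.antidiagonal 3).over (w.1.adicCompletion L)) M} | a γ x = x ∧ IsVertexLattice (galAdicCompletionMap (L := L) (IsCMField.complexConj L) hw) ϖ ((StdForm.antidiagonal 3).over (w.1.adicCompletion L)) 0 x.1}, ρ.levelTrace (hUo x) (hUc x) γ⁻¹) +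
      ∑ᶠ x ∈ {x : {M : Submodule 𝒪[(w.1.adicCompletion L)] (Fin 3 → (w.1.adicCompletion L)) // IsVertex (galAdicCompletionMap (L := L) (IsCMField.complexConj L) hw) ϖ ((StdForm.antidiagonal 3).over (w.1.adicCompletion L)) M} | a γ x = x ∧ IsVertexLattice (galAdicCompletionMap (L := L) (IsCMField.complexConj L) hw) ϖ ((StdForm.antidiagonal 3).over (w.1.adicCompletion L)) 2 x.1}, ρ.levelTrace (hUo x) (hUc x) γ⁻¹ =
        ∑ x ∈ hfin.toFinset, ρ.levelTrace (hUo x) (hUc x) γ⁻¹ := by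
    rw [← finsum_mem_union hdisj (hfin.subset fun x hx => hx.1) (hfin.subset fun x hx => hx.1), hcover, finsum_mem_eq_finite_toFinset_sum _ hfin]
  have hedge : ∑ᶠ d ∈ {d : (latticeGraph (galAdicCompletionMap (L := L) (IsCMField.complexConj L) hw) ϖ ((StdForm.antidiagonal 3).over (w.1.adicCompletion L))).edgeSet | (a γ).mapEdgeSet d = d}, ρ.levelTrace (hEo d) (hEc d) γ⁻¹ = ∑ d ∈ hfinE.toFinset, ρ.levelTrace (hEo d) (hEc d) γ⁻¹ :=
    finsum_mem_eq_finite_toFinset_sum _ hfinE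
  rw [← hEP, Fin.sum_univ_three] at hsum
  simp only [Matrix.cons_val_zero, Matrix.cons_val_one, Matrix.cons_val_two, Matrix.head_cons, Matrix.tail_cons] at hsum
  rw [hsum]
  exact epSum_arith (hne P₀ hP₀o hP₀c) (hne P₂ hP₂o hP₂c) (hne P₁ hP₁o hP₁c) h₀ h₂ h₁ hvert hedge

end Head

end Summit.HodgeConjecture.HodgeConjecture.Cruxes.H413.F0P3cStCharTSEPFunctionOrbitalElliptic

end
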